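import Literature.MathematicalPhysics.QuantumFieldTheory.Balaban1983to89.HaarDensityOrthogonalExplicit
import Literature.MathematicalPhysics.QuantumFieldTheory.Balaban1983to89.HaarExponentialChartMeasure

/-!
# `Balaban1983to89.HaarDensityOrthogonalChart` — [Balaban1985UV3] p. 260, THE HAAR MEASURE OF `SO(N)` IN EXPONENTIAL
# COORDINATES WITH THE EXPLICIT DENSITY `Π_{j<k} sinc((θ_j + θ_k)/2)`:
# `∫_{V_s} F dμ = c · ∫_{‖A‖<s} F(e^A) Π_{j<k} sin((θ_j+θ_k)/2)/((θ_j+θ_k)/2) dA`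

statement-level skeleton of published theorems with citation tags; proofs where landed; nothing here is a claim
about the Yang–Mills mass gap

Mega-formalization `lit-balaban` (HOME `run/shared/lean/pub/lit-balaban/`), unit `lit-balaban-p28` gen 12 (Phase-2
proof seat, free-target protocol G.5-34(d); TAKING 2026-08-22T16:55Z).  The `SO(N)` analogue of the gen-11 glue file F7
`HaarDensityUnitaryChart` (`U(N)`/`SU(N)`): it threads the explicit determinant of `HaarDensityOrthogonalExplicit`
(`det jac_{𝔬(N)}(x) = Π_{j<k} sinc((θ_j + θ_k)/2)`, stated on `orthogonalLie` in the `L^∞`-operator norm scope) into the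
MEASURE-LEVEL Haar statement of gen 10 for every closed subgroup of `U(N)`
(`HaarExponentialChartMeasure.lintegral_haar_unitarySubgroup_window_eq`, `L²`-operator scope), closing HONEST SCOPE
(i) of `HaarDensityOrthogonalExplicit`.  SKELETON rows served (SUPPORT cells only, no head change): B10.Eq21 / display
E18 ([Balaban1985UV3] (18)/(21) pp. 260–261, owner r07), B13.Eq1.37 / Lem2 (owner r10), B12.Eq2.10–2.12 (r09/r20).

CITATION HEADER.  [Balaban1985UV3] T. Bałaban, CMP **102** (1985) 255–275, p. 260: *«dU′ = σ(A′)dA′ … σ(A′) is a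
density which can be calculated explicitly for all classical groups»*.  [Helgason2000] Ch. I §1 **Thm. 1.14** (12)/(13)
p. 96 — tree: r10 `B13HaarSigmaJacobian.jac`, `det_jac_real_eq_sigmaRel`, `det_jac_real_nonneg`; gen 10
`HaarExponentialChart.jacDensity`, `lintegral_haar_unitarySubgroup_window_eq`; gen 8 `LogChartClosedSubgroup`
(`unitarySubgroupLogChart`, `LogChart.lie_eq_of_carrier_eq`).  [Sepanski2007] §6.1.5.3 **Lemma 6.12** (PDF p. 168):
*«SO(E_n) is a compact Lie subgroup of SU(n) with Lie algebra 𝔰𝔬(E_n) … SO(n) ≅ SO(E_n)»*; §6.1.5.4–5 (types `D`, `B`).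
[Hall2015] Cor. 3.44 (the Lie algebra of a matrix Lie group is determined by the group).

WHAT IS PROVED (definition `specialOrthogonalSubgroup` with body + theorems; 0 named facts, 0 sorry; axioms standard).
* §1 **`specialOrthogonalSubgroup n` = `SO(N) ≤ U(N)`** (real entries, `det = 1`; `isClosed_specialOrthogonalSubgroup`);
  read in `M_N(ℂ)` it is the carrier of the tree's `specialOrthogonalLogChart` (`image_val_specialOrthogonalSubgroup`,
  `unitarySubgroupLogChart_carrier_eq`).
* §2 **`unitarySubgroupLogChart_lie_eq`: the log-chart Lie algebra of `SO(N) ≤ U(N)` IS `𝔬(N) = orthogonalLie n`**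
  (`specialOrthogonalLogChart_lie_eq`: `𝔰𝔲(N) ∩ M_N(ℝ)` = real antisymmetric; then `LogChart.lie_eq_of_carrier_eq`).
* §3 NORM-FREE TRANSFER `sigmaRel_toMatrix_eq_prod_sinc_of_diag`: for ANY real subspace `𝐠 = 𝔬(N)`, basis `b`, linear
  `T` acting as `ad(−x)`, `x = U·diag(iθ)·U*`: `σrel([T]_b ⊗ ℂ) = Π_{j<k} sinc((θ_j + θ_k)/2)`.
* §4 ON THE CHART (`L²`-operator scope): **`det_jac_specialOrthogonal_eq_prod_sinc_of_diag`**,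
  **`jacDensity_specialOrthogonal_eq_of_diag`: `jacDensity x = ofReal (Π_{j<k} sinc((θ_j + θ_k)/2))`**, and the
  hypothesis-free `jacDensity_specialOrthogonal_eq` (`θ = eigenvalues(−ix)`).
* §5 **THE HAAR MEASURE OF `SO(N)` IN EXPONENTIAL COORDINATES, EXPLICIT DENSITY**:
  `lintegral_haar_specialOrthogonal_window_eq_prod_sinc_of_diag` — for every Haar measure `μ` on `SO(N)`, every
  Lebesgue measure `η` on `𝔬(N)`, `0 < s ≤ s_C`, measurable `F ≥ 0` and any unitary diagonalisation
  `A = U(A)diag(iθ(A))U(A)*`: `∫_{V_s} F dμ = (μ(V_s) / ∫_{‖A‖<s} ρ dη) · ∫_{‖A‖<s} F(e^A) ρ(A) dη(A)` with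
  **`ρ(A) = Π_{j<k} sinc((θ_j(A) + θ_k(A))/2)`**;
  hypothesis-free `lintegral_haar_specialOrthogonal_window_eq_prod_sinc` (`θ(A)` = eigenvalues of `−iA`).

HONEST SCOPE.  (i) `SO(N)` only (`U(N)`/`SU(N)`: F7; `Sp(n)`: determinant level only, `HaarDensitySymplecticExplicit`).
(ii) The normalising constant is left as `μ(V_s)/∫ρ` exactly as in the gen-10 statement (print's `σ₀`).  (iii) The
group is `SO(N)` realised inside `U(N)` as a `Subgroup (Matrix.unitaryGroup n ℂ)` (real entries, `det = 1`), `N ≥ 1`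
(`Nonempty n`); `O(N)` has the same Lie algebra and is not treated separately.  (iv) Nothing of gen 8/10, r10, F7 or
`HaarDensityOrthogonalExplicit` is re-proved; this file only threads them.
-/

noncomputable section

open scoped ENNReal
open Module Polynomial Matrix MeasureTheory
open _root_.Complex (I)

namespace Literature.MathematicalPhysics.QuantumFieldTheory.Balaban1983to89.HaarDensityOrthogonalChart

open B13HaarSigma (sigmaRel)
open B13HaarSigmaJacobian (adg jac adg_apply_coe hlie_lieSubalgebra det_jac_real_eq_sigmaRel det_jac_real_nonneg)
open HaarDensityUnitaryExplicit (isHermitian_neg_I_smul)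
open HaarDensityOrthogonalExplicit (orthogonalLie mem_orthogonalLie_iff mem_orthogonalLie_iff_real
  map_conj_eq_of_mem_orthogonalLie det_jac_orthogonalLie_eq_prod_sinc_of_diag eq_unitary_mul_diagonal_mul_star)
open Literature.Algebra.Lie.CompactKillingForm (unitaryLie mem_unitaryLie_iff)
open LogChartClosedSubgroup (unitarySubgroupLogChart unitarySubgroupLogChart_carrier)
open HaarExponentialChart (jacDensity jacDensity_def isChartRep_unitarySubgroup lie_adStable_unitarySubgroup
  lintegral_haar_unitarySubgroup_window_eq)

-- Mathlib idiom (as in `B12LieComplexification`, `B13HaarSigmaJacobian` §7, `CompactKillingForm`, F2–F7): the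
-- commutator bracket on an associative ring is the NON-instance `LieRing.ofAssociativeRing`, enabled file-locally; it
-- overrides nothing (no global `LieRing (Matrix n n ℂ)`), and `orthogonalLie` is stated with it.
attribute [local instance 100] LieRing.ofAssociativeRing

variable {n : Type*} [Fintype n] [DecidableEq n]

/-! ## §1  `SO(N) ≤ U(N)`: the real unitaries of determinant one, a closed subgroup -/

section Subgroup

open scoped Matrix.Norms.L2Operator

/-- **`SO(N)` as a subgroup of `U(N)`**: the unitaries with real entries and determinant `1` (print: «G ⊂ U(N)»).
[cite: Sepanski2007, §6.1.5.3 Lemma 6.12 (b)] [cite: Balaban1987RG1, §0 pp.251–252] -/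
def specialOrthogonalSubgroup (n : Type*) [Fintype n] [DecidableEq n] : Subgroup (Matrix.unitaryGroup n ℂ) where
  carrier := {u | conjEntry n (u : Matrix n n ℂ) = u ∧ (u : Matrix n n ℂ).det = 1}
  mul_mem' {a b} ha hb := by
    refine ⟨?_, ?_⟩
    · rw [Submonoid.coe_mul, map_mul, ha.1, hb.1]
    · rw [Submonoid.coe_mul, det_mul, ha.2, hb.2, mul_one]
  one_mem' := ⟨map_one (conjEntry n), det_one⟩
  inv_mem' {a} ha := by
    refine ⟨?_, ?_⟩
    · rw [Matrix.UnitaryGroup.inv_val, conjEntry_star, ha.1]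
    · rw [Matrix.UnitaryGroup.inv_val, star_eq_conjTranspose, det_conjTranspose, ha.2, star_one]

/-- Membership: real entries and `det = 1`. [cite: Sepanski2007, §6.1.5.3 Lemma 6.12 (b)] -/
theorem mem_specialOrthogonalSubgroup_iff {u : Matrix.unitaryGroup n ℂ} :
    u ∈ specialOrthogonalSubgroup n ↔ conjEntry n (u : Matrix n n ℂ) = u ∧ (u : Matrix n n ℂ).det = 1 := Iff.rfl

/-- **`SO(N)` is closed in `U(N)`.** [cite: Sepanski2007, §6.1.5.3 Lemma 6.12 (a)] -/
theorem isClosed_specialOrthogonalSubgroup :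
    IsClosed (specialOrthogonalSubgroup n : Set (Matrix.unitaryGroup n ℂ)) :=
  (isClosed_eq (continuous_conjEntry.comp continuous_subtype_val) continuous_subtype_val).inter
    (isClosed_eq continuous_subtype_val.matrix_det continuous_const)

variable [Nonempty n]

/-- `SO(N) ≤ U(N)` read in `M_N(ℂ)` is the carrier of the tree's `specialOrthogonalLogChart`.
[cite: Sepanski2007, §6.1.5.3 Lemma 6.12 (a)] -/
theorem image_val_specialOrthogonalSubgroup :
    (Subtype.val '' (specialOrthogonalSubgroup n : Set (Matrix.unitaryGroup n ℂ)) : Set (Matrix n n ℂ)) =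
      (specialOrthogonalLogChart n).carrier := by
  ext A
  rw [mem_specialOrthogonalLogChart_carrier, Matrix.mem_specialUnitaryGroup_iff]
  constructor
  · rintro ⟨u, hu, rfl⟩
    exact ⟨⟨u.2, hu.2⟩, hu.1⟩
  · rintro ⟨⟨hU, hdet⟩, hreal⟩
    exact ⟨⟨A, hU⟩, ⟨hreal, hdet⟩, rfl⟩

/-- The log-chart of `SO(N) ≤ U(N)` has the same carrier as `specialOrthogonalLogChart`.
[cite: Sepanski2007, §6.1.5.3 Lemma 6.12 (a)] -/
theorem unitarySubgroupLogChart_carrier_eq :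
    (unitarySubgroupLogChart (specialOrthogonalSubgroup n) isClosed_specialOrthogonalSubgroup).carrier =
      (specialOrthogonalLogChart n).carrier := by
  rw [unitarySubgroupLogChart_carrier, image_val_specialOrthogonalSubgroup]

end Subgroup

/-! ## §2  Its Lie algebra is `𝔬(N)` -/

section Lie

open scoped Matrix.Norms.L2Operator

omit [DecidableEq n] in
/-- The trace of an antisymmetric matrix vanishes. [folklore] -/
private theorem trace_eq_zero_of_transpose_eq_neg {X : Matrix n n ℂ} (hX : Xᵀ = -X) : X.trace = 0 := by
  have h : X.trace = -X.trace := by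
    conv_lhs => rw [← trace_transpose X, hX, trace_neg]
  have h2 : (2 : ℂ) * X.trace = 0 := by rw [two_mul]; nth_rewrite 1 [h]; exact neg_add_cancel _
  exact (mul_eq_zero.1 h2).resolve_left two_ne_zero

variable [Nonempty n]

/-- **The Lie algebra of the `SO(N)` chart is `𝔬(N)`**: `𝔰𝔲(N) ∩ M_N(ℝ)` = the real antisymmetric matrices (a real
skew-Hermitian matrix is antisymmetric, and then automatically traceless).
[cite: Sepanski2007, §6.1.5.3 Lemma 6.12 (a)] -/
theorem specialOrthogonalLogChart_lie_eq : (specialOrthogonalLogChart n).lie = (orthogonalLie n).toSubmodule := by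
  ext X
  change X ∈ (specialUnitaryLogChart n).lie ⊓ (realLogChart n).lie ↔ _
  rw [Submodule.mem_inf, mem_specialUnitaryLogChart_lie, realLogChart_lie, mem_realMatrix, conjEntry_apply,
    LieSubalgebra.mem_toSubmodule, mem_orthogonalLie_iff_real, star_eq_conjTranspose]
  constructor
  · rintro ⟨⟨hH, -⟩, hreal⟩
    refine ⟨?_, hreal⟩
    have h : Xᴴᵀ = (-X)ᵀ := by rw [hH]
    rw [conjTranspose_transpose, transpose_neg] at h
    -- h : X.map star = -Xᵀ
    have hreal' : X.map star = X := hreal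
    rw [hreal'] at h
    rw [← neg_neg Xᵀ, ← h]
  · rintro ⟨hT, hreal⟩
    refine ⟨⟨?_, trace_eq_zero_of_transpose_eq_neg hT⟩, hreal⟩
    have hreal' : X.map star = X := hreal
    rw [conjTranspose, hT, Matrix.map_neg _ star_neg, hreal']

/-- **The log-chart Lie algebra of `SO(N) ≤ U(N)` is `𝔬(N)`** (two log-charts with the same carrier have the same Lie
algebra, gen 8's `LogChart.lie_eq_of_carrier_eq`). [cite: Sepanski2007, §6.1.5.3 Lemma 6.12 (a)]
[cite: Hall2015, Cor. 3.44] -/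
theorem unitarySubgroupLogChart_lie_eq :
    (unitarySubgroupLogChart (specialOrthogonalSubgroup n) isClosed_specialOrthogonalSubgroup).lie =
      (orthogonalLie n).toSubmodule := by
  rw [LogChart.lie_eq_of_carrier_eq unitarySubgroupLogChart_carrier_eq, specialOrthogonalLogChart_lie_eq]

end Lie

/-! ## §3  Norm-free transfer: `σrel([ad(−x)]_b ⊗ ℂ) = Π_{j<k} sinc((θ_j + θ_k)/2)` on any copy of `𝔬(N)` -/

section Transfer

open scoped Matrix.Norms.Operator

/-- **Norm-free form of `det_jac_orthogonalLie_eq_prod_sinc_of_diag`**: for any real subspace `𝐠 = 𝔬(N)` of `M_N(ℂ)`,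
any basis `b`, any linear `T` on `𝐠` acting as `ad(−x) = (y ↦ yx − xy)` and `x = U·diag(iθ)·U*`:
`σrel([T]_b ⊗ ℂ) = Π_{j<k} sinc((θ_j + θ_k)/2)` (r10's `det_jac_real_eq_sigmaRel` read backwards) — so that the closed
form can be read in ANY norm scope. [cite: Balaban1985UV3, p. 260] [cite: Helgason2000, Ch. I §1 Thm. 1.14 (12) p. 96]
[cite: Sepanski2007, §6.1.5.4, §6.1.5.5, Thm. 5.14] -/
theorem sigmaRel_toMatrix_eq_prod_sinc_of_diag [LinearOrder n] {𝔤 : Submodule ℝ (Matrix n n ℂ)}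
    (h𝔤 : 𝔤 = (orthogonalLie n).toSubmodule) {ι : Type*} [Fintype ι] [DecidableEq ι] (b : Basis ι ℝ 𝔤) (x : 𝔤)
    (T : 𝔤 →ₗ[ℝ] 𝔤) (hT : ∀ y : 𝔤, ((T y : 𝔤) : Matrix n n ℂ) = (y : Matrix n n ℂ) * x - x * y)
    (U : Matrix.unitaryGroup n ℂ) (θ : n → ℝ)
    (hx : (x : Matrix n n ℂ) = (U : Matrix n n ℂ) * diagonal (fun j => I * (θ j : ℂ)) * star (U : Matrix n n ℂ)) :
    sigmaRel ((LinearMap.toMatrix b b T).map (algebraMap ℝ ℂ)) =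
      algebraMap ℝ ℂ (∏ p ∈ (Finset.univ : Finset (n × n)).filter (fun p => p.1 < p.2),
        Real.sinc ((θ p.1 + θ p.2) / 2)) := by
  subst h𝔤
  have hT' : T = ((adg (hlie_lieSubalgebra (orthogonalLie n)) (-x) :
      (orthogonalLie n).toSubmodule →L[ℝ] (orthogonalLie n).toSubmodule) :
        (orthogonalLie n).toSubmodule →ₗ[ℝ] (orthogonalLie n).toSubmodule) := by
    ext y : 2
    rw [hT, ContinuousLinearMap.coe_coe, adg_apply_coe, Submodule.coe_neg]
    noncomm_ring
  rw [hT', ← det_jac_real_eq_sigmaRel, det_jac_orthogonalLie_eq_prod_sinc_of_diag x U θ hx]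

end Transfer

/-! ## §4  On the `SO(N)` chart: `det jac = Π_{j<k} sinc`, `jacDensity = ofReal (Π_{j<k} sinc)` -/

section Chart

open scoped Matrix.Norms.L2Operator

variable [Nonempty n] [LinearOrder n]

omit [LinearOrder n] in
/-- `x` in the `SO(N)` chart's Lie algebra is skew-Hermitian. [cite: Sepanski2007, §6.1.5.3 Lemma 6.12 (a)] -/
theorem conjTranspose_eq_neg_of_mem_lie
    (x : (unitarySubgroupLogChart (specialOrthogonalSubgroup n) isClosed_specialOrthogonalSubgroup).lie) :
    (x : Matrix n n ℂ)ᴴ = -x :=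
  (mem_orthogonalLie_iff.1 ((unitarySubgroupLogChart_lie_eq (n := n)) ▸ x.2 :
    (x : Matrix n n ℂ) ∈ (orthogonalLie n).toSubmodule)).1

/-- **`det jac(x) = Π_{j<k} sinc((θ_j + θ_k)/2)` on the `SO(N)` chart's Lie algebra** for `x = U·diag(iθ)·U*`.
[cite: Balaban1985UV3, p. 260] [cite: Helgason2000, Ch. I §1 Thm. 1.14 (12) p. 96]
[cite: Sepanski2007, §6.1.5.4, §6.1.5.5] -/
theorem det_jac_specialOrthogonal_eq_prod_sinc_of_diag
    (x : (unitarySubgroupLogChart (specialOrthogonalSubgroup n) isClosed_specialOrthogonalSubgroup).lie)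
    (U : Matrix.unitaryGroup n ℂ) (θ : n → ℝ)
    (hx : (x : Matrix n n ℂ) = (U : Matrix n n ℂ) * diagonal (fun j => I * (θ j : ℂ)) * star (U : Matrix n n ℂ)) :
    LinearMap.det (jac (lie_adStable_unitarySubgroup (specialOrthogonalSubgroup n) isClosed_specialOrthogonalSubgroup)
        x : (unitarySubgroupLogChart (specialOrthogonalSubgroup n) isClosed_specialOrthogonalSubgroup).lie →ₗ[ℝ]
          (unitarySubgroupLogChart (specialOrthogonalSubgroup n) isClosed_specialOrthogonalSubgroup).lie) =
      ∏ p ∈ (Finset.univ : Finset (n × n)).filter (fun p => p.1 < p.2), Real.sinc ((θ p.1 + θ p.2) / 2) := by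
  classical
  apply (algebraMap ℝ ℂ).injective
  have hT : ∀ y : (unitarySubgroupLogChart (specialOrthogonalSubgroup n) isClosed_specialOrthogonalSubgroup).lie,
      ((((adg (lie_adStable_unitarySubgroup (specialOrthogonalSubgroup n) isClosed_specialOrthogonalSubgroup) (-x) :
        (unitarySubgroupLogChart (specialOrthogonalSubgroup n) isClosed_specialOrthogonalSubgroup).lie →L[ℝ]
          (unitarySubgroupLogChart (specialOrthogonalSubgroup n) isClosed_specialOrthogonalSubgroup).lie) :
        (unitarySubgroupLogChart (specialOrthogonalSubgroup n) isClosed_specialOrthogonalSubgroup).lie →ₗ[ℝ]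
          (unitarySubgroupLogChart (specialOrthogonalSubgroup n) isClosed_specialOrthogonalSubgroup).lie) y :
        (unitarySubgroupLogChart (specialOrthogonalSubgroup n) isClosed_specialOrthogonalSubgroup).lie) :
          Matrix n n ℂ) = (y : Matrix n n ℂ) * x - x * y := fun y => by
    rw [ContinuousLinearMap.coe_coe, adg_apply_coe, Submodule.coe_neg]
    noncomm_ring
  rw [det_jac_real_eq_sigmaRel (lie_adStable_unitarySubgroup (specialOrthogonalSubgroup n)
    isClosed_specialOrthogonalSubgroup) (Module.finBasis ℝ _) x]
  exact sigmaRel_toMatrix_eq_prod_sinc_of_diag unitarySubgroupLogChart_lie_eq (Module.finBasis ℝ _) x _ hT U θ hx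

/-- **`jacDensity x = ofReal (Π_{j<k} sinc((θ_j + θ_k)/2))` on the `SO(N)` chart** (`|det jac| = det jac ≥ 0`, r10's
`det_jac_real_nonneg`). [cite: Balaban1985UV3, p. 260] [cite: Helgason2000, Ch. I §1 Thm. 1.14 (12) p. 96] -/
theorem jacDensity_specialOrthogonal_eq_of_diag
    (x : (unitarySubgroupLogChart (specialOrthogonalSubgroup n) isClosed_specialOrthogonalSubgroup).lie)
    (U : Matrix.unitaryGroup n ℂ) (θ : n → ℝ)
    (hx : (x : Matrix n n ℂ) = (U : Matrix n n ℂ) * diagonal (fun j => I * (θ j : ℂ)) * star (U : Matrix n n ℂ)) :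
    jacDensity (lie_adStable_unitarySubgroup (specialOrthogonalSubgroup n) isClosed_specialOrthogonalSubgroup) x =
      ENNReal.ofReal (∏ p ∈ (Finset.univ : Finset (n × n)).filter (fun p => p.1 < p.2),
        Real.sinc ((θ p.1 + θ p.2) / 2)) := by
  rw [jacDensity_def, abs_of_nonneg (det_jac_real_nonneg _ x), det_jac_specialOrthogonal_eq_prod_sinc_of_diag x U θ hx]

/-- **`jacDensity x = ofReal (Π_{j<k} sinc((θ_j + θ_k)/2))`, `θ = eigenvalues(−ix)`** (hypothesis-free).
[cite: Balaban1985UV3, p. 260] [cite: Helgason2000, Ch. I §1 Thm. 1.14 (12) p. 96] -/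
theorem jacDensity_specialOrthogonal_eq
    (x : (unitarySubgroupLogChart (specialOrthogonalSubgroup n) isClosed_specialOrthogonalSubgroup).lie) :
    jacDensity (lie_adStable_unitarySubgroup (specialOrthogonalSubgroup n) isClosed_specialOrthogonalSubgroup) x =
      ENNReal.ofReal (∏ p ∈ (Finset.univ : Finset (n × n)).filter (fun p => p.1 < p.2),
        Real.sinc (((isHermitian_neg_I_smul (conjTranspose_eq_neg_of_mem_lie x)).eigenvalues p.1 +
          (isHermitian_neg_I_smul (conjTranspose_eq_neg_of_mem_lie x)).eigenvalues p.2) / 2)) :=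
  jacDensity_specialOrthogonal_eq_of_diag x _ _ (eq_unitary_mul_diagonal_mul_star (conjTranspose_eq_neg_of_mem_lie x))

end Chart

/-! ## §5  The Haar measure of `SO(N)` in exponential coordinates with the explicit density -/

section Haar

open scoped Matrix.Norms.L2Operator

variable [Nonempty n] [LinearOrder n]

/-- **HAAR MEASURE OF `SO(N)` IN EXPONENTIAL COORDINATES, EXPLICIT DENSITY** ([Balaban1985UV3] p. 260 «dU′ = σ(A′)dA′
… calculated explicitly for all classical groups», the orthogonal series): for every Haar measure `μ` on `SO(N) ≤ U(N)`,
every Lebesgue measure `η` on `𝔬(N)`, `0 < s ≤ s_C`, measurable `F ≥ 0` and any unitary diagonalisation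
`A = U(A)·diag(iθ(A))·U(A)*` of the elements of `𝔬(N)`:
`∫_{V_s} F dμ = (μ(V_s) / ∫_{‖A‖<s} ρ dη) · ∫_{‖A‖<s} F(e^A) ρ(A) dη(A)`,
**`ρ(A) = Π_{j<k} sinc((θ_j(A) + θ_k(A))/2)`**. [cite: Balaban1985UV3, p. 260]
[cite: Helgason2000, Ch. I §1 Thm. 1.14 (13) p. 96] [cite: Sepanski2007, §6.1.5.4, §6.1.5.5] -/
theorem lintegral_haar_specialOrthogonal_window_eq_prod_sinc_of_diag
    [MeasurableSpace (unitarySubgroupLogChart (specialOrthogonalSubgroup n) isClosed_specialOrthogonalSubgroup).lie]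
    [BorelSpace (unitarySubgroupLogChart (specialOrthogonalSubgroup n) isClosed_specialOrthogonalSubgroup).lie]
    (η : Measure (unitarySubgroupLogChart (specialOrthogonalSubgroup n) isClosed_specialOrthogonalSubgroup).lie)
    [η.IsAddHaarMeasure] (μ : Measure (specialOrthogonalSubgroup n)) [μ.IsHaarMeasure] {s : ℝ} (hs0 : 0 < s)
    (hs : s ≤ HaarExponentialChart.IsChartRep.chartRadius
      (unitarySubgroupLogChart (specialOrthogonalSubgroup n) isClosed_specialOrthogonalSubgroup))
    {F : specialOrthogonalSubgroup n → ℝ≥0∞} (hF : Measurable F)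
    (U : (unitarySubgroupLogChart (specialOrthogonalSubgroup n) isClosed_specialOrthogonalSubgroup).lie →
      Matrix.unitaryGroup n ℂ)
    (θ : (unitarySubgroupLogChart (specialOrthogonalSubgroup n) isClosed_specialOrthogonalSubgroup).lie → n → ℝ)
    (hUθ : ∀ A : (unitarySubgroupLogChart (specialOrthogonalSubgroup n) isClosed_specialOrthogonalSubgroup).lie,
      (A : Matrix n n ℂ) = (U A : Matrix n n ℂ) * diagonal (fun j => I * (θ A j : ℂ)) * star (U A : Matrix n n ℂ)) :
    ∫⁻ g in (isChartRep_unitarySubgroup (specialOrthogonalSubgroup n) isClosed_specialOrthogonalSubgroup).window s,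
        F g ∂μ =
      (μ ((isChartRep_unitarySubgroup (specialOrthogonalSubgroup n) isClosed_specialOrthogonalSubgroup).window s) /
          ∫⁻ A in Metric.ball 0 s, ENNReal.ofReal (∏ p ∈ (Finset.univ : Finset (n × n)).filter (fun p => p.1 < p.2),
            Real.sinc ((θ A p.1 + θ A p.2) / 2)) ∂η) *
        ∫⁻ A in Metric.ball 0 s,
          F ((isChartRep_unitarySubgroup (specialOrthogonalSubgroup n) isClosed_specialOrthogonalSubgroup).expChart A) *
            ENNReal.ofReal (∏ p ∈ (Finset.univ : Finset (n × n)).filter (fun p => p.1 < p.2),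
              Real.sinc ((θ A p.1 + θ A p.2) / 2)) ∂η := by
  have hρ : ∀ A : (unitarySubgroupLogChart (specialOrthogonalSubgroup n) isClosed_specialOrthogonalSubgroup).lie,
      jacDensity (lie_adStable_unitarySubgroup (specialOrthogonalSubgroup n) isClosed_specialOrthogonalSubgroup) A =
        ENNReal.ofReal (∏ p ∈ (Finset.univ : Finset (n × n)).filter (fun p => p.1 < p.2),
          Real.sinc ((θ A p.1 + θ A p.2) / 2)) :=
    fun A => jacDensity_specialOrthogonal_eq_of_diag A (U A) (θ A) (hUθ A)
  have h := lintegral_haar_unitarySubgroup_window_eq (specialOrthogonalSubgroup n) isClosed_specialOrthogonalSubgroup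
    η μ hs0 hs hF
  simp only [hρ] at h
  exact h

/-- **HAAR MEASURE OF `SO(N)` IN EXPONENTIAL COORDINATES, EXPLICIT DENSITY, hypothesis-free**:
`ρ(A) = Π_{j<k} sinc((θ_j(A) + θ_k(A))/2)` with `θ(A)` = the eigenvalues of the Hermitian matrix `−iA`.
[cite: Balaban1985UV3, p. 260] [cite: Helgason2000, Ch. I §1 Thm. 1.14 (13) p. 96] -/
theorem lintegral_haar_specialOrthogonal_window_eq_prod_sinc
    [MeasurableSpace (unitarySubgroupLogChart (specialOrthogonalSubgroup n) isClosed_specialOrthogonalSubgroup).lie]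
    [BorelSpace (unitarySubgroupLogChart (specialOrthogonalSubgroup n) isClosed_specialOrthogonalSubgroup).lie]
    (η : Measure (unitarySubgroupLogChart (specialOrthogonalSubgroup n) isClosed_specialOrthogonalSubgroup).lie)
    [η.IsAddHaarMeasure] (μ : Measure (specialOrthogonalSubgroup n)) [μ.IsHaarMeasure] {s : ℝ} (hs0 : 0 < s)
    (hs : s ≤ HaarExponentialChart.IsChartRep.chartRadius
      (unitarySubgroupLogChart (specialOrthogonalSubgroup n) isClosed_specialOrthogonalSubgroup))
    {F : specialOrthogonalSubgroup n → ℝ≥0∞} (hF : Measurable F) :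
    ∫⁻ g in (isChartRep_unitarySubgroup (specialOrthogonalSubgroup n) isClosed_specialOrthogonalSubgroup).window s,
        F g ∂μ =
      (μ ((isChartRep_unitarySubgroup (specialOrthogonalSubgroup n) isClosed_specialOrthogonalSubgroup).window s) /
          ∫⁻ A in Metric.ball 0 s, ENNReal.ofReal (∏ p ∈ (Finset.univ : Finset (n × n)).filter (fun p => p.1 < p.2),
            Real.sinc (((isHermitian_neg_I_smul (conjTranspose_eq_neg_of_mem_lie A)).eigenvalues p.1 +
              (isHermitian_neg_I_smul (conjTranspose_eq_neg_of_mem_lie A)).eigenvalues p.2) / 2)) ∂η) *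
        ∫⁻ A in Metric.ball 0 s,
          F ((isChartRep_unitarySubgroup (specialOrthogonalSubgroup n) isClosed_specialOrthogonalSubgroup).expChart A) *
            ENNReal.ofReal (∏ p ∈ (Finset.univ : Finset (n × n)).filter (fun p => p.1 < p.2),
              Real.sinc (((isHermitian_neg_I_smul (conjTranspose_eq_neg_of_mem_lie A)).eigenvalues p.1 +
                (isHermitian_neg_I_smul (conjTranspose_eq_neg_of_mem_lie A)).eigenvalues p.2) / 2)) ∂η :=
  lintegral_haar_specialOrthogonal_window_eq_prod_sinc_of_diag η μ hs0 hs hF _ _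
    fun A => eq_unitary_mul_diagonal_mul_star (conjTranspose_eq_neg_of_mem_lie A)

end Haar

end Literature.MathematicalPhysics.QuantumFieldTheory.Balaban1983to89.HaarDensityOrthogonalChart
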